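import Literature.AlgebraicGeometry.Motives.SmoothProperLocallyTrivial
import Literature.AlgebraicGeometry.Motives.AlgebraicEquivalenceFibreDimension
import Literature.AlgebraicGeometry.HodgeTheory.HyperplaneClassHardLefschetzPullback
import Literature.AlgebraicGeometry.HodgeTheory.HardLefschetzComplexification
import Literature.AlgebraicGeometry.HodgeTheory.InvariantClassesFromTotalSpaceProofs
import Literature.AlgebraicTopology.Homotopy.SerreFibrationInvariantCycles
import Literature.AlgebraicTopology.Homotopy.WhiteheadContractibleLeavesProofs
import Literature.AlgebraicTopology.Homotopy.HomotopyEquivWeakEquivProofs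
import HarnessLib

/-!
# Deligne's invariant cycle theorem for smooth projective families, and the discharge of `deligne1968_invariantClass_fromTotalSpace`

Family `hodge`, layer `Literature/AlgebraicGeometry/HodgeTheory`. Source: C. Voisin, *Hodge Theory
and Complex Algebraic Geometry II* (CUP 2003), Def. 4.14, Thm. 4.15, §4.3.1, Lemma 4.17 and
Thm. 4.18 (PDF pp. 124–126); P. Deligne, *Théorème de Lefschetz et critères de dégénérescence de
suites spectrales*, Publ. Math. IHÉS 35 (1968), Thm. 1.5 and Prop. 2.1.

## Main results

* `invariantCycles_of_isSmoothProjectiveFamily` — **Voisin II Thm. 4.18 (the `ℚ`-statement) for a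
  smooth projective family** `f : 𝒳 ⟶ S` (`Motives.IsSmoothProjectiveFamily f n₀`) over a smooth
  separated quasi-compact base, with `𝒳` immersed in some `ℙᵐ`: every flat section
  `y ∈ H⁰(S(ℂ), Rᵏ f(ℂ)_* ℚ)` (`Motives.IsFlatSection`) is the family of restrictions of one class
  `z ∈ Hᵏ(𝒳(ℂ); ℚ)`.
* `deligne1968_invariantClass_fromTotalSpace_holds` — the discharge of the named fact
  `deligne1968_invariantClass_fromTotalSpace` (file `InvariantClassesFromTotalSpace`): the printed
  consequence "a global section of `Rᵏ f_* ℂ` through `α` comes from `β ∈ Hᵏ(𝒳(ℂ); ℂ)`", by the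
  tree's reduction `deligne1968_invariantClass_fromTotalSpace_of_invariantCycles` (universal
  coefficients `⊗ ℂ`) run with the theorem above in place of the general named fact
  `Motives.Voisin2003_invariantCycles`.

## Proof (following Deligne 1968 / Voisin II §4.2.3–4.3.2, in singular HOMOLOGY)

Write `p = f(ℂ) : 𝒳(ℂ) → S(ℂ)`.
1. *`p` is a Serre fibration* (`Motives.isSerreFibration_map_of_smooth_proper`: Ehresmann on the
   equidimensional pieces, Voisin I Thm. 9.3, glued; locally trivial ⇒ Serre, Hatcher Prop. 4.48).
2. *Relative hard Lefschetz* (the hypothesis of Voisin II Thm. 4.15, "`L = c₁(𝓛)`, `𝓛` relatively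
   ample"): with `ε : 𝒳 ⟶ ℙᵐ` an immersion and `r₀` spanning `H²(ℙᵐ(ℂ); ℂ)`, the class
   `η = ε(ℂ)^* r₀ ∈ H²(𝒳(ℂ); ℂ)` restricts on every fibre `𝒳_s ↪ ℙᵐ` (a closed immersion of the
   smooth projective `n₀`-fold `𝒳_s`) to a class with the hard Lefschetz property
   (`exists_forall_hasHardLefschetzProperty_map`, from hodge.S14 for Kähler classes, Voisin I
   Thm. 6.25), transported to the topological fibre `p⁻¹(s) ≃ₜ 𝒳_s(ℂ)` and dualised to the cap
   product (`SerreInvariantCycles.capHardLefschetz_of_hasHardLefschetzProperty`); the fibres have no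
   homology above degree `2n₀` (`ComplexPoints.isZero_singularHomology_of_lt`).
3. *Degeneration and the edge map* — the topological heart, proved in
   `Literature/AlgebraicTopology/Homotopy/SerreFibrationInvariantCycles.lean`
   (`SerreInvariantCycles.exists_class_of_flat_of_cover`): over each equidimensional piece `S_M(ℂ)`
   of the base (a manifold, with a CW model by Milnor's theorem,
   `Manifold.exists_cwComplex_homotopyEquiv_holds`) Deligne's criterion applied to the Leray–Serre
   exact couple of the skeletal filtration with the Lefschetz endomorphism `η ⌢ ·` makes the edge
   `H_k(fibre) → H_k(total)` as injective as `H_k(fibre) → H_k(p⁻¹(1-skeleton))`, whence (field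
   coefficients, Kronecker duality) every flat family of fibre classes extends; the pieces are glued
   over the clopen partition `{p⁻¹S_M(ℂ)}`.
4. *Coefficients.* The theorem of step 3 is applied over `ℂ` to the complexified family
   `s ↦ ι(y_s)`; a `ℚ`-linear retraction `g : ℂ → ℚ` of `ℚ ⊆ ℂ` applied to the coefficients
   (`mapCoeff_scalarChange_map`, `mapCoeff_scalarChange_smul_ringChange`) turns the complex class
   into a rational one with the same restrictions.

No definition and no named fact is introduced (D-0026).

## References

* [VoisinHodgeII2003] C. Voisin, Hodge Theory and Complex Algebraic Geometry II (CUP 2003),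
  Def. 4.14, Thm. 4.15, §4.3.1, Lemma 4.17, Thm. 4.18.
* [Deligne1968] P. Deligne, Théorème de Lefschetz et critères de dégénérescence de suites
  spectrales, Publ. Math. IHÉS 35 (1968), Thm. 1.5, Prop. 2.1.
* [VoisinHodgeI2002] C. Voisin, Hodge Theory and Complex Algebraic Geometry I (CUP 2002), Thm. 6.25,
  Thm. 9.3, §9.2.1.
* [HatcherAT2002] A. Hatcher, Algebraic Topology (CUP 2002), §3.1 Thm. 3.2, §3.3, §4.2 Prop. 4.48.
* [Milnor1959] J. Milnor, On spaces having the homotopy type of a CW-complex, Trans. AMS 90 (1959),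
  Cor. 1.
-/

noncomputable section

open CategoryTheory AlgebraicGeometry Filter TopologicalSpace Set Function
open scoped Manifold ContDiff Topology
open Literature.AlgebraicTopology.SingularHomology
open Literature.AlgebraicTopology.Homotopy
open Literature.Algebra.Homology Literature.Geometry.Kaehler

namespace Literature.AlgebraicGeometry.HodgeTheory

open _root_.Topology
open Literature.AlgebraicGeometry.Motives

universe u

section Family

variable {𝒳 S : Motives.SchemeOver ℂ} (f : 𝒳 ⟶ S)

/-- The fibre `𝒳_t` of a proper family embeds into `ℙᵐ` by a closed immersion as soon as `𝒳` does
so by a preimmersion (`𝒳_t ↪ 𝒳` is a closed immersion, `𝒳_t → ℙᵐ` is proper). Local copy of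
`isClosedImmersion_fiberι_comp_left` (file `AlgebraicityLocusLinearSections`, not imported here).
[folklore] -/
private theorem isClosedImmersion_fiberι_comp_left₁ [IsProper f.left] [LocallyOfFiniteType S.hom]
    {m : ℕ} (ε : 𝒳 ⟶ projectiveSpace m ℂ) [IsPreimmersion ε.left] (t : Motives.ComplexPoints S) :
    IsClosedImmersion (Motives.fiberι f t ≫ ε).left := by
  haveI : IsClosedImmersion t.left := AlgPoints.isClosedImmersion_toSpecHom S t
  haveI : IsClosedImmersion (Motives.fiberι f t).left :=
    MorphismProperty.pullback_fst (P := @IsClosedImmersion) f.left t.left inferInstance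
  haveI : IsPreimmersion (Motives.fiberι f t ≫ ε).left := by
    rw [Over.comp_left]
    infer_instance
  haveI : IsProper (Motives.fiberOver f t).hom := isProper_fiberOver_hom f t
  haveI : IsProper (projectiveSpace m ℂ).hom := isProper_projectiveSpace m ℂ
  haveI : IsProper ((Motives.fiberι f t ≫ ε).left ≫ (projectiveSpace m ℂ).hom) := by
    rw [Over.w]
    infer_instance
  haveI : IsProper (Motives.fiberι f t ≫ ε).left :=
    IsProper.of_comp (Motives.fiberι f t ≫ ε).left (projectiveSpace m ℂ).hom
  exact IsClosedImmersion.of_isPreimmersion _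
    (Motives.fiberι f t ≫ ε).left.isClosedMap.isClosed_range

/-- **The equidimensional pieces of `S(ℂ)` and their CW models.** For `S` smooth, separated and
quasi-compact over `ℂ`, the complex points of the equidimensional pieces `S_M`
(`Motives.exists_smoothPieces`) are pairwise disjoint open subsets covering `S(ℂ)`, and each has
the weak homotopy type of a Hausdorff CW complex: `S_M(ℂ)` is a second countable Hausdorff
topological `2M`-manifold (`ComplexPoints.chartedSpace`), so Milnor's theorem
(`Manifold.exists_cwComplex_homotopyEquiv_holds`) applies. [cite: Milnor1959, Cor. 1]
[cite: GortzWedhorn2020, Thm. 6.28] -/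
theorem exists_cover_cwModels (S : Motives.SchemeOver ℂ) [Smooth S.hom] [IsSeparated S.hom]
    [CompactSpace S.left] :
    ∃ Bp : ℕ → Set (Motives.ComplexPoints S), (∀ i, IsOpen (Bp i)) ∧
      (∀ i j, i ≠ j → Disjoint (Bp i) (Bp j)) ∧ (∀ b, ∃ i, b ∈ Bp i) ∧
      ∀ i, ∃ (X : Type) (_ : TopologicalSpace X) (_ : T2Space X)
        (_ : CWComplex (univ : Set X)) (h : C(X, ↥(Bp i))), IsWeakHomotopyEquiv h := by
  classical
  haveI : LocallyOfFiniteType S.hom := inferInstance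
  haveI : T2Space (ComplexPoints S) := ComplexPoints.t2Space_of_isSeparated S
  haveI : SecondCountableTopology (ComplexPoints S) :=
    ComplexPoints.secondCountableTopology_of_compactSpace_holds S
  obtain ⟨piece, hsm, hcov, hdisj, -⟩ := exists_smoothPieces S
  refine ⟨fun M => {t | t.pt ∈ piece M}, fun M => AlgPoints.isOpen_setOf_pt_mem _,
    fun M M' hne => ?_, fun b => ?_, fun M => ?_⟩
  · exact Set.disjoint_left.2 fun t ht ht' => hne (hdisj t M M' ht ht')
  · obtain ⟨M, hM⟩ := hcov b.pt
    exact ⟨M, hM⟩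
  -- the open subscheme `S_M` and its complex points
  let SM : SchemeOver ℂ := Over.mk ((piece M).ι ≫ S.hom)
  let ιM : SM ⟶ S := Over.homMk (piece M).ι
  haveI : IsOpenImmersion ιM.left := inferInstanceAs (IsOpenImmersion (piece M).ι)
  haveI : SmoothOfRelativeDimension M SM.hom := hsm M
  haveI : Smooth SM.hom := SmoothOfRelativeDimension.smooth M _
  haveI : LocallyOfFiniteType SM.hom := inferInstance
  haveI : IsSeparated SM.hom := inferInstanceAs (IsSeparated ((piece M).ι ≫ S.hom))
  haveI : T2Space (ComplexPoints SM) := ComplexPoints.t2Space_of_isSeparated SM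
  have hemb := AlgPoints.isEmbedding_map (L := ℂ) ιM
  haveI : SecondCountableTopology (ComplexPoints SM) := hemb.secondCountableTopology
  letI := ComplexPoints.chartedSpace SM M
  have hrange : Set.range (AlgPoints.map ιM : ComplexPoints SM → ComplexPoints S) =
      {t | t.pt ∈ piece M} := by
    rw [AlgPoints.range_map_of_isOpenImmersion_holds ιM]
    ext t
    change t.pt ∈ ((piece M).ι).opensRange ↔ t.pt ∈ piece M
    rw [Scheme.Opens.opensRange_ι]
  let φ : ComplexPoints SM ≃ₜ ↥({t : ComplexPoints S | t.pt ∈ piece M}) :=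
    hemb.toHomeomorph.trans (Homeomorph.setCongr hrange)
  obtain ⟨C, _, _, _, -, ⟨e⟩⟩ :=
    Manifold.exists_cwComplex_homotopyEquiv_holds (2 * M) (ComplexPoints SM)
  refine ⟨C, inferInstance, inferInstance, inferInstance,
    (φ : C(ComplexPoints SM, ↥({t : ComplexPoints S | t.pt ∈ piece M}))).comp e.symm.toFun, ?_⟩
  exact (IsWeakHomotopyEquiv.of_homeomorph φ).comp (isWeakHomotopyEquiv_homotopyEquiv e.symm)

/-- A `ℚ`-linear retraction of `ℚ ⊆ ℂ`. [folklore] -/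
private theorem exists_dual_apply_one : ∃ g : ℂ →ₗ[ℚ] ℚ, g 1 = 1 := by
  obtain ⟨g₀, hg₀⟩ : ∃ g₀ : Module.Dual ℚ ℂ, g₀ 1 ≠ 0 := by
    by_contra h
    push Not at h
    exact one_ne_zero ((Module.forall_dual_apply_eq_zero_iff ℚ (1 : ℂ)).1 h)
  exact ⟨(g₀ 1)⁻¹ • g₀, by rw [LinearMap.smul_apply, smul_eq_mul, inv_mul_cancel₀ hg₀]⟩

/-- **Deligne's invariant cycle theorem (Voisin II, Thm. 4.18, `ℚ`-statement) for a smooth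
projective family.** Let `f : 𝒳 ⟶ S` be a smooth projective family of relative dimension `n₀`
(`IsSmoothProjectiveFamily`: smooth of relative dimension `n₀`, proper, with smooth projective
geometrically irreducible fibres) over a smooth separated quasi-compact `ℂ`-scheme `S`, with `𝒳`
immersed in some `ℙᵐ` (so every fibre `𝒳_s ↪ ℙᵐ` is a closed immersion). Then every flat section
`y` of `Rᵏ f(ℂ)_* ℚ` is the family of restrictions of one class `z ∈ Hᵏ(𝒳(ℂ); ℚ)`:
`Hᵏ(𝒳(ℂ), ℚ) → H⁰(S(ℂ), Rᵏ f_* ℚ)` is surjective. See the module docstring for the proof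
(Serre fibration, relative hard Lefschetz from the hyperplane class, Deligne's degeneration
criterion on the Leray–Serre exact couple, universal coefficients).
[cite: VoisinHodgeII2003, Thm. 4.18 (with Def. 4.14, Thm. 4.15, §4.3.1, Lemma 4.17)]
[cite: Deligne1968, Thm. 1.5 and Prop. 2.1] -/
theorem invariantCycles_of_isSmoothProjectiveFamily {n₀ : ℕ} (hf : IsSmoothProjectiveFamily f n₀)
    [Smooth S.hom] [IsSeparated S.hom] [CompactSpace S.left]
    {m : ℕ} (ε : 𝒳 ⟶ projectiveSpace m ℂ) [IsPreimmersion ε.left] (k : ℕ)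
    (y : ∀ s : Motives.ComplexPoints S, Motives.bettiCohomology (Motives.fiberOver f s) k)
    (hy : Motives.IsFlatSection f k y) :
    ∃ z : Motives.bettiCohomology 𝒳 k,
      ∀ s, (Motives.bettiCohomology.map (Motives.fiberι f s) k).hom z = y s := by
  classical
  haveI : IsProper f.left := hf.isProper
  haveI : Smooth f.left := hf.smooth
  haveI : LocallyOfFiniteType S.hom := inferInstance
  haveI : IsSeparated 𝒳.hom := by rw [← Over.w f]; infer_instance
  haveI : T2Space (ComplexPoints 𝒳) := ComplexPoints.t2Space_of_isSeparated 𝒳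
  have hp : IsSerreFibration (AlgPoints.map f : ComplexPoints 𝒳 → ComplexPoints S) :=
    isSerreFibration_map_of_smooth_proper f
  -- the topological fibres are the scheme-theoretic fibres
  have he : ∀ s : ComplexPoints S, ∃ e : ComplexPoints (fiberOver f s) ≃ₜ
      ↥((AlgPoints.map f : ComplexPoints 𝒳 → ComplexPoints S) ⁻¹' {s}),
      ∀ x, ((e x : ↥((AlgPoints.map f : ComplexPoints 𝒳 → ComplexPoints S) ⁻¹' {s})) :
        ComplexPoints 𝒳) = AlgPoints.map (fiberι f s) x := fun s => exists_fiberHomeomorph f s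
  choose e he using he
  have hefac : ∀ s, (subsetIncl ((AlgPoints.map f : ComplexPoints 𝒳 → ComplexPoints S) ⁻¹' {s})).comp
      (e s : C(ComplexPoints (fiberOver f s), ↥((AlgPoints.map f : ComplexPoints 𝒳 → ComplexPoints S) ⁻¹' {s}))) =
      AlgPoints.mapContinuous (L := ℂ) (fiberι f s) := fun s => ContinuousMap.ext (he s)
  -- the Lefschetz class `η = ε^* r₀`
  obtain ⟨r₀, hr₀⟩ := exists_forall_hasHardLefschetzProperty_map m
  -- hard Lefschetz on the fibres `𝒳_s(ℂ)` (cup product)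
  have hHLs : ∀ s : ComplexPoints S, HasHardLefschetzProperty
      (singularCohomology.map ℂ ℂ (AlgPoints.mapContinuous (L := ℂ) (fiberι f s)) 2
        (singularCohomology.map ℂ ℂ (AlgPoints.mapContinuous (L := ℂ) ε) 2 r₀)) n₀ := by
    intro s
    haveI := isClosedImmersion_fiberι_comp_left₁ f ε s
    have h := hr₀ (hf.isSmoothProjective s) (fiberι f s ≫ ε)
    rwa [AlgPoints.mapContinuous_comp, singularCohomology.map_comp, ModuleCat.comp_apply] at h
  -- hard Lefschetz on the topological fibres (cap product)
  have hHL : ∀ (b : ComplexPoints S) (lo i : ℕ), lo + i = n₀ → i ≤ n₀ →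
      Bijective (iterDown
        (V := fun k => singularHomology ℂ ℂ ↥((AlgPoints.map f : ComplexPoints 𝒳 → ComplexPoints S) ⁻¹' {b}) k)
        (fun k => capProduct (show 2 + k = k + 2 by omega)
          (singularCohomology.map ℂ ℂ
            (subsetIncl ((AlgPoints.map f : ComplexPoints 𝒳 → ComplexPoints S) ⁻¹' {b})) 2
            (singularCohomology.map ℂ ℂ (AlgPoints.mapContinuous (L := ℂ) ε) 2 r₀))) i lo) := by
    intro b lo i hloi _
    refine SerreInvariantCycles.capHardLefschetz_of_hasHardLefschetzProperty ℂ _ ?_ lo i hloi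
    rw [← hasHardLefschetzProperty_map_homeomorph_iff (e b) _ n₀, ← ModuleCat.comp_apply,
      ← singularCohomology.map_comp, hefac b]
    exact hHLs b
  -- no fibre homology above degree `2 n₀`
  have hvan : ∀ (b : ComplexPoints S) (k : ℕ), 2 * n₀ < k →
      ∀ c : singularHomology ℂ ℂ ↥((AlgPoints.map f : ComplexPoints 𝒳 → ComplexPoints S) ⁻¹' {b}) k,
        c = 0 := by
    intro b k hk c
    haveI := ModuleCat.subsingleton_of_isZero
      (ComplexPoints.isZero_singularHomology_of_lt (hf.isSmoothProjective b) ℂ ℂ hk)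
    haveI := isIso_singularHomology_map_of_isWeakHomotopyEquiv ℂ _
      (IsWeakHomotopyEquiv.of_homeomorph (e b).symm) k
    apply (SerreFlat.bijective_hom_of_isIso (singularHomology.map ℂ ℂ
      ((e b).symm : C(↥((AlgPoints.map f : ComplexPoints 𝒳 → ComplexPoints S) ⁻¹' {b}),
        ComplexPoints (fiberOver f b))) k)).1
    exact Subsingleton.elim _ _
  -- the complexified family on the topological fibres, and its flatness
  let y' : ∀ b : ComplexPoints S,
      singularCohomology ℂ ℂ ↥((AlgPoints.map f : ComplexPoints 𝒳 → ComplexPoints S) ⁻¹' {b}) k :=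
    fun b => singularCohomology.map ℂ ℂ
      ((e b).symm : C(↥((AlgPoints.map f : ComplexPoints 𝒳 → ComplexPoints S) ⁻¹' {b}),
        ComplexPoints (fiberOver f b))) k
      (singularCohomology.ringChange (algebraMap ℚ ℂ) (ComplexPoints (fiberOver f b)) k (y b))
  have hy' : ∀ b₀ : ComplexPoints S, ∃ V ∈ 𝓝 b₀,
      ∃ g : singularCohomology ℂ ℂ ↥((AlgPoints.map f : ComplexPoints 𝒳 → ComplexPoints S) ⁻¹' V) k,
        ∀ (b : ComplexPoints S) (hb : b ∈ V),
          singularCohomology.map ℂ ℂ (subsetInclusion (SerreFlat.fibre_subset_preimage hb)) k g =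
            y' b := by
    intro b₀
    obtain ⟨V, hV, g, hg⟩ := hy b₀
    obtain ⟨e₃, he₃⟩ := exists_tubeHomeomorph f V
    refine ⟨V, hV, singularCohomology.map ℂ ℂ
      (e₃.symm : C(↥((AlgPoints.map f : ComplexPoints 𝒳 → ComplexPoints S) ⁻¹' V), Motives.tube f V)) k
      (singularCohomology.ringChange (algebraMap ℚ ℂ) (Motives.tube f V) k g), fun b hb => ?_⟩
    have hfac : (e₃.symm : C(↥((AlgPoints.map f : ComplexPoints 𝒳 → ComplexPoints S) ⁻¹' V), Motives.tube f V)).comp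
        (subsetInclusion (SerreFlat.fibre_subset_preimage hb)) =
        (Motives.fiberToTube f V b hb).comp
          ((e b).symm : C(↥((AlgPoints.map f : ComplexPoints 𝒳 → ComplexPoints S) ⁻¹' {b}),
            ComplexPoints (fiberOver f b))) := by
      refine ContinuousMap.ext fun v => Subtype.ext ?_
      have h1 := he₃ (e₃.symm (subsetInclusion (SerreFlat.fibre_subset_preimage hb) v))
      rw [Homeomorph.apply_symm_apply] at h1
      have h2 := he b ((e b).symm v)
      rw [Homeomorph.apply_symm_apply] at h2
      change ((e₃.symm (subsetInclusion (SerreFlat.fibre_subset_preimage hb) v) : Motives.tube f V) :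
          ComplexPoints 𝒳) = AlgPoints.map (fiberι f b) ((e b).symm v)
      rw [← h2, ← h1]
      rfl
    rw [← ModuleCat.comp_apply, ← singularCohomology.map_comp, hfac, singularCohomology.map_comp,
      ModuleCat.comp_apply, ← ringChange_map]
    change _ = singularCohomology.map ℂ ℂ
      ((e b).symm : C(↥((AlgPoints.map f : ComplexPoints 𝒳 → ComplexPoints S) ⁻¹' {b}),
        ComplexPoints (fiberOver f b))) k
      (singularCohomology.ringChange (algebraMap ℚ ℂ) (ComplexPoints (fiberOver f b)) k (y b))
    rw [← hg b hb]
    rfl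
  -- the base pieces and the topological theorem over `ℂ`
  obtain ⟨Bp, hBo, hBd, hBc, hCW⟩ := exists_cover_cwModels S
  obtain ⟨z', hz'⟩ := SerreInvariantCycles.exists_class_of_flat_of_cover ℂ hp Bp hBo hBd hBc hCW
    (singularCohomology.map ℂ ℂ (AlgPoints.mapContinuous (L := ℂ) ε) 2 r₀) hHL hvan y' hy'
  have hres : ∀ s, singularCohomology.map ℂ ℂ (AlgPoints.mapContinuous (L := ℂ) (fiberι f s)) k z' =
      singularCohomology.ringChange (algebraMap ℚ ℂ) (ComplexPoints (fiberOver f s)) k (y s) := by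
    intro s
    rw [← hefac s, singularCohomology.map_comp, ModuleCat.comp_apply, hz' s]
    exact SerreFlat.map_homeomorph_map_symm ℂ (e s) k _
  -- descent of coefficients along a `ℚ`-linear retraction of `ℚ ⊆ ℂ`
  obtain ⟨g, hg1⟩ := exists_dual_apply_one
  refine ⟨singularCohomology.mapCoeff (ComplexPoints 𝒳) g k
    (singularCohomology.scalarChange ℂ ℚ ℂ (ComplexPoints 𝒳) k z'), fun s => ?_⟩
  change singularCohomology.map ℚ ℚ (AlgPoints.mapContinuous (L := ℂ) (fiberι f s)) k _ = y s
  rw [← mapCoeff_scalarChange_map, hres s]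
  have h1 := mapCoeff_scalarChange_smul_ringChange ℚ g (1 : ℂ) (y s)
  rw [one_smul, hg1, one_smul] at h1
  exact h1

/-! ### The discharge of `deligne1968_invariantClass_fromTotalSpace` -/

/-- **Discharge of the named fact `deligne1968_invariantClass_fromTotalSpace`** (Voisin II,
Thm. 4.18 in the form consumed downstream: for a smooth projective family `f : 𝒳 ⟶ S` over a
quasi-projective smooth base with `𝒳` quasi-projective, a continuous section of the espace étalé
of `Rᵏ f_* ℂ` through `α ∈ Hᵏ(𝒳_{s₀}(ℂ); ℂ)` comes from a class `β ∈ Hᵏ(𝒳(ℂ); ℂ)`). The tree's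
reduction `deligne1968_invariantClass_fromTotalSpace_of_invariantCycles` verbatim (flat coordinate
`ℚ`-sections, universal coefficients "`⊗ ℂ`" on the compact manifold `𝒳_{s₀}(ℂ)`), with the
`ℚ`-statement supplied by `invariantCycles_of_isSmoothProjectiveFamily` for the immersion
`𝒳 ⊆ P ⊆ ℙᵐ` given by quasi-projectivity of `𝒳`.
[cite: VoisinHodgeII2003, Thm. 4.18 (with Def. 4.14, Thm. 4.15, Lemma 4.17)]
[cite: Deligne1968, Thm. 1.5 and Prop. 2.1] [cite: HatcherAT2002, §3.1 Thm. 3.2 and §3.A Cor. 3A.4] -/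
theorem deligne1968_invariantClass_fromTotalSpace_holds : deligne1968_invariantClass_fromTotalSpace := by
  intro 𝒳 S f n hf h𝒳 hS hSs k sec hsec hpt s₀
  classical
  haveI : Smooth S.hom := hSs
  haveI : IsSeparated S.hom := hS.isVarietyPair_ofScheme.isSeparated
  haveI : QuasiCompact S.hom := hS.isVarietyPair_ofScheme.quasiCompact
  haveI : CompactSpace S.left := QuasiCompact.compactSpace_of_compactSpace S.hom
  haveI : IsProper f.left := hf.isProper
  have hU := isCohomologicallyLocallyTrivialOn_univ_of_isQuasiProjectiveOver f hf hS hSs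
  -- the immersion `𝒳 ⊆ P ⊆ ℙᵐ`
  obtain ⟨P, j, ⟨m, κ, hκ⟩, hj⟩ := h𝒳
  haveI := hκ
  haveI := hj
  haveI : IsPreimmersion (j ≫ κ).left := by
    rw [Over.comp_left]
    infer_instance
  -- the `ℚ`-statement, applied to flat `ℚ`-sections of this family
  have hXf : ∀ y : ∀ s : Motives.ComplexPoints S, Motives.bettiCohomology (Motives.fiberOver f s) k,
      Motives.IsFlatSection f k y → ∃ z : Motives.bettiCohomology 𝒳 k,
        ∀ s, (Motives.bettiCohomology.map (Motives.fiberι f s) k).hom z = y s :=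
    fun y hy ↦ invariantCycles_of_isSmoothProjectiveFamily f hf (j ≫ κ) k y hy
  -- the class at `s₀`
  set x : complexBetti (Motives.fiberOver f s₀) k := (sec s₀).clsAt (hpt s₀) with hxdef
  have hσ₀ : sec s₀ = ⟨s₀, x⟩ := (FiberClass.mk_clsAt _ _).symm
  -- finiteness and universal coefficients on the compact manifold `𝒳_{s₀}(ℂ)`
  have hXs : Motives.IsSmoothProjective n (Motives.fiberOver f s₀) := hf.isSmoothProjective s₀
  haveI : Module.Finite ℚ
      (singularCohomology ℚ ℚ (Motives.ComplexPoints (Motives.fiberOver f s₀)) k) := by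
    letI := hXs.chartedSpace
    haveI := Motives.ComplexPoints.compactSpace_of_isSmoothProjective hXs
    haveI := Motives.ComplexPoints.t2Space_of_isSmoothProjective hXs
    exact finite_singularCohomology_of_compact_chartedSpace ℚ ℚ (d := 2 * n) k
  haveI : Module.Finite ℂ
      (singularCohomology ℂ ℂ (Motives.ComplexPoints (Motives.fiberOver f s₀)) k) := by
    letI := hXs.chartedSpace
    haveI := Motives.ComplexPoints.compactSpace_of_isSmoothProjective hXs
    haveI := Motives.ComplexPoints.t2Space_of_isSmoothProjective hXs
    exact finite_singularCohomology_of_compact_chartedSpace ℂ ℂ (d := 2 * n) k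
  have hdim :
      Module.finrank ℂ (singularCohomology ℂ ℂ (Motives.ComplexPoints (Motives.fiberOver f s₀)) k) =
        Module.finrank ℚ
          (singularCohomology ℚ ℚ (Motives.ComplexPoints (Motives.fiberOver f s₀)) k) := by
    rw [finrank_singularCohomology_eq_bettiNumber_of_field,
      finrank_singularCohomology_eq_bettiNumber_of_field, bettiNumber_eq_of_algebra ℚ ℂ]
  set bL := Module.Basis.ofVectorSpace ℚ ℂ with hbL
  obtain ⟨sJ, hsum⟩ := exists_finset_sum_smul_ringChange_mapCoeff_eq ℚ hdim bL x
  -- flat coordinate sections and their lifts to `Hᵏ(𝒳(ℂ); ℚ)`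
  have hflat := fun j ↦ isFlatSection_mapCoeff_clsAt f k hU hsec hpt (bL.coord j)
  choose z hz using fun j ↦ hXf _ (hflat j)
  refine ⟨∑ j ∈ sJ, bL j • singularCohomology.ringChange (algebraMap ℚ ℂ)
    (Motives.ComplexPoints 𝒳) k (z j), ?_⟩
  rw [hσ₀]
  change (⟨s₀, x⟩ : FiberClass f k) = ⟨s₀, complexBetti.map (Motives.fiberι f s₀) k _⟩
  rw [FiberClass.mk_eq_mk_iff, map_sum, ← hsum]
  refine Finset.sum_congr rfl fun j _ ↦ ?_
  rw [map_smul]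
  congr 1
  change _ = singularCohomology.map ℂ ℂ
    (Motives.AlgPoints.mapContinuous (L := ℂ) (Motives.fiberι f s₀)) k
      (singularCohomology.ringChange (algebraMap ℚ ℂ) (Motives.ComplexPoints 𝒳) k (z j))
  rw [← ringChange_map, ← hz j s₀]

end Family

end Literature.AlgebraicGeometry.HodgeTheory

end
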